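import Summits.AtomisticToContinuum.FouriersLaw.Theses.PhononMeanFreePath
import Summits.AtomisticToContinuum.FouriersLaw.Theorems.BoundaryKubo.Negative.LoadBearing
import Summits.AtomisticToContinuum.FouriersLaw.Theorems.BondHeatUncertaintySubdiffusiveBondHeatKernelGibbsC

/-!
# Equilibrium sum rule, helper 1: Doob–Dynkin for the energy along the reversed Langevin equation
(helpers for stub `stub_sumRule` of line `gibbs-ttcf`, crux stmt-AtomisticToContinuum-11812
`PhononMeanFreePath.BoundaryKubo`)

For an oscillator chain with confining `C²` potentials, `N ≥ 1` sites, both baths at `T > 0`, write `ρ = e^{-H/T}`,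
`S = p_0² + p_{N-1}²`, `L̂ = sdeGenerator (-Y) v_L(T) v_R(T)` for the generator of the time-reversed (anti-friction)
Langevin equation and `P̂_s = langevinRevKernel` for its transition kernels.

* `revGenerator_truncGibbsH_sub_le` — `L̂ (H ρ χ(H/R)) = χ(H/R) · (γ(2T - S) - 2γH) ρ + O(1/R)` uniformly
  (`χ = smoothCutoff`; `revGenerator_comp_hamiltonian` for the profile `h ↦ h e^{-h/T} χ(h/R)`; the main part is
  `L̂(ρH) = ρ · LH - 2γ ρH` with `LH = γ(2T - S)` the forward generator of the energy);
* `gibbsDensityH_langevinRevKernel_identity` — for `u ≥ 0` and every `y`: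
  `e^{2γu} P̂_u(Hρ)(y) - H(y)ρ(y) = ∫₀ᵘ e^{2γs} P̂_s(γ(2T - S)ρ)(y) ds`
  (Dynkin for the truncations, dominated convergence `R → ∞`, integrating factor `e^{2γs}`). This is the Doob–Dynkin
  identity `e^{2γt}P̂_t(ρf) - ρf = ∫₀ᵗ e^{2γs}P̂_s(ρ (L(f∘Θ))∘Θ) ds` of `…KernelDoobTransform` extended from `C²_c` to
  the (momentum-even) energy `f = H`.
-/

noncomputable section

open scoped NNReal ENNReal Topology
open MeasureTheory Filter Set

namespace Summit.AtomisticToContinuum.FouriersLaw.Theorems.BoundaryKubo.GibbsTtcf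

open Literature.MathematicalPhysics.KineticTheory.HeatConduction
open Literature.MathematicalPhysics.KineticTheory Literature.Probability.Process OscillatorChain
open ProbabilityTheory
open Summit.AtomisticToContinuum.FouriersLaw.Theorems.SubdiffusiveBondHeat

variable {P : OscillatorChain} {N : ℕ}

/-- `h² e^{-h/T} ≤ 4T²` for `h ≥ 0`, `T > 0` (square of `h e^{-h/(2T)} ≤ 2T`). [folklore] -/
theorem sq_mul_exp_neg_div_le {T : ℝ} (hT : 0 < T) {h : ℝ} (hh : 0 ≤ h) :
    h ^ 2 * Real.exp (-h / T) ≤ 4 * T ^ 2 := by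
  have h1 : h * Real.exp (-h / (2 * T)) ≤ 2 * T := mul_exp_neg_div_le (by positivity) h
  have h0 : 0 ≤ h * Real.exp (-h / (2 * T)) := mul_nonneg hh (Real.exp_pos _).le
  have h2 : (h * Real.exp (-h / (2 * T))) ^ 2 ≤ (2 * T) ^ 2 := pow_le_pow_left₀ h0 h1 2
  have h3 : (h * Real.exp (-h / (2 * T))) ^ 2 = h ^ 2 * Real.exp (-h / T) := by
    rw [mul_pow, sq (Real.exp _), ← Real.exp_add]; congr 2; field_simp; ring
  nlinarith [h2, h3]

/-- **The reversed generator of the truncated energy-weighted Gibbs density** at equal bath temperatures `T > 0`.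
For confining `C²` potentials with `U, V ≥ 0`, `N ≥ 1`, `γ ≥ 0` and `R ≥ 1`, with `S = p_0² + p_{N-1}²`:
`|L̂ (H e^{-H/T} χ(H/R)) - χ(H/R) (γ(2T - S) - 2γH) e^{-H/T}| ≤ C/R` uniformly on phase space
(`revGenerator_comp_hamiltonian` for the profile `h e^{-h/T}χ(h/R)`; the `χ`-terms give the main part
`γ e^{-H/T}[(1 - H/T)(2T + S) + T(-2/T + H/T²)S] = γ e^{-H/T}(2T - S - 2H)`, the `χ', χ''` terms carry `1/R` and
the bounded weights `e^{-H/T}(H + S + HS)`). [folklore] -/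
theorem revGenerator_truncGibbsH_sub_le (hU : ContDiff ℝ 2 P.U) (hV : ContDiff ℝ 2 P.V)
    (hU0 : ∀ q, 0 ≤ P.U q) (hV0 : ∀ r, 0 ≤ P.V r) (hN : 0 < N) (hγ : 0 ≤ P.γ) {T : ℝ} (hT : 0 < T) :
    ∃ C : ℝ, ∀ R : ℝ, 1 ≤ R → ∀ x : PhaseSpace N,
      |sdeGenerator (fun y => -P.drift N y) (P.bathVecL N T) (P.bathVecR N T)
          (fun y => P.hamiltonian N y *
            (Real.exp (-P.hamiltonian N y / T) * smoothCutoff (P.hamiltonian N y / R))) x -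
        smoothCutoff (P.hamiltonian N x / R) *
          ((P.γ * (2 * T - (x.2 ⟨0, hN⟩ ^ 2 + x.2 ⟨N - 1, Nat.sub_lt hN one_pos⟩ ^ 2)) -
              2 * P.γ * P.hamiltonian N x) * Real.exp (-P.hamiltonian N x / T))| ≤ C / R := by
  obtain ⟨M₁, hM₁0, hM₁⟩ := exists_bound_deriv_smoothCutoff
  obtain ⟨M₂, hM₂0, hM₂⟩ := exists_bound_deriv_deriv_smoothCutoff
  refine ⟨P.γ * (M₁ * (26 * T ^ 2) + M₂ * (16 * T ^ 3)), fun R hR x => ?_⟩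
  have hR0 : 0 < R := lt_of_lt_of_le one_pos hR
  have hTγ : 0 ≤ P.γ * T := mul_nonneg hγ hT.le
  -- derivatives of the profile `φ_R(h) = h · e^{-h/T} χ(h/R)`
  have hF : ∀ u, HasDerivAt (fun h => h * (Real.exp (-h / T) * smoothCutoff (h / R)))
      (Real.exp (-u / T) * smoothCutoff (u / R) +
        u * (-(1 / T) * (Real.exp (-u / T) * smoothCutoff (u / R)) +
          Real.exp (-u / T) * deriv smoothCutoff (u / R) / R)) u := fun u => by
    have h := (hasDerivAt_id' u).mul (hasDerivAt_truncProfile T R u)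
    exact h.congr_deriv (by ring)
  have hF' : ∀ u, HasDerivAt (fun h => Real.exp (-h / T) * smoothCutoff (h / R) +
        h * (-(1 / T) * (Real.exp (-h / T) * smoothCutoff (h / R)) +
          Real.exp (-h / T) * deriv smoothCutoff (h / R) / R))
      ((-(1 / T) * (Real.exp (-u / T) * smoothCutoff (u / R)) +
          Real.exp (-u / T) * deriv smoothCutoff (u / R) / R) +
        ((-(1 / T) * (Real.exp (-u / T) * smoothCutoff (u / R)) +
            Real.exp (-u / T) * deriv smoothCutoff (u / R) / R) +
          u * ((1 / T ^ 2) * (Real.exp (-u / T) * smoothCutoff (u / R)) -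
            (2 / (T * R)) * (Real.exp (-u / T) * deriv smoothCutoff (u / R)) +
            Real.exp (-u / T) * deriv (deriv smoothCutoff) (u / R) / R ^ 2))) u := fun u => by
    have h := (hasDerivAt_truncProfile T R u).add
      ((hasDerivAt_id' u).mul (hasDerivAt_deriv_truncProfile hT.ne' hR0.ne' u))
    exact h.congr_deriv (by ring)
  rw [revGenerator_comp_hamiltonian hU hV hN hTγ hTγ hF hF' x]
  -- notation
  set Hx := P.hamiltonian N x with hHx
  set E := Real.exp (-Hx / T) with hE
  set χ₀ := smoothCutoff (Hx / R)
  set χ₁ := deriv smoothCutoff (Hx / R)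
  set χ₂ := deriv (deriv smoothCutoff) (Hx / R)
  set A := x.2 ⟨0, hN⟩ ^ 2 with hA
  set B := x.2 ⟨N - 1, Nat.sub_lt hN one_pos⟩ ^ 2 with hB
  have hA0 : 0 ≤ A := sq_nonneg _
  have hB0 : 0 ≤ B := sq_nonneg _
  have hE0 : 0 < E := Real.exp_pos _
  have hH0 : 0 ≤ Hx := P.hamiltonian_nonneg_of_nonneg hU0 hV0 N x
  have hE1 : E ≤ 1 := by
    rw [hE, Real.exp_le_one_iff, neg_div]
    exact neg_nonpos.2 (div_nonneg hH0 hT.le)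
  -- `A + B ≤ 4 H`, `E H ≤ T`, `E (A + B) ≤ 4T`, `E H (A + B) ≤ 16 T²`
  have hSH : A + B ≤ 4 * Hx := by
    have hk := P.kinetic_le_hamiltonian_of_nonneg hU0 hV0 N x
    have h1 : x.2 ⟨0, hN⟩ ^ 2 / 2 ≤ ∑ i, x.2 i ^ 2 / 2 :=
      Finset.single_le_sum (f := fun i => x.2 i ^ 2 / 2) (fun i _ => by positivity) (Finset.mem_univ _)
    have h2 : x.2 ⟨N - 1, Nat.sub_lt hN one_pos⟩ ^ 2 / 2 ≤ ∑ i, x.2 i ^ 2 / 2 :=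
      Finset.single_le_sum (f := fun i => x.2 i ^ 2 / 2) (fun i _ => by positivity) (Finset.mem_univ _)
    rw [hA, hB]; linarith
  have hEH : E * Hx ≤ T := by rw [mul_comm]; exact mul_exp_neg_div_le hT Hx
  have hES : E * (A + B) ≤ 4 * T := by
    calc E * (A + B) ≤ E * (4 * Hx) := mul_le_mul_of_nonneg_left hSH hE0.le
      _ = 4 * (E * Hx) := by ring
      _ ≤ 4 * T := by linarith
  have hEHS : E * Hx * (A + B) ≤ 16 * T ^ 2 := by
    have h2 : Hx ^ 2 * E ≤ 4 * T ^ 2 := sq_mul_exp_neg_div_le hT hH0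
    calc E * Hx * (A + B) ≤ E * Hx * (4 * Hx) := mul_le_mul_of_nonneg_left hSH (mul_nonneg hE0.le hH0)
      _ = 4 * (Hx ^ 2 * E) := by ring
      _ ≤ 4 * (4 * T ^ 2) := by linarith
      _ = 16 * T ^ 2 := by ring
  -- the algebraic identity: the `χ` terms give the main part, the error carries `1/R`
  have key : P.γ * ((E * χ₀ + Hx * (-(1 / T) * (E * χ₀) + E * χ₁ / R)) * (T + T + A + B) +
      (-(1 / T) * (E * χ₀) + E * χ₁ / R + (-(1 / T) * (E * χ₀) + E * χ₁ / R +
        Hx * (1 / T ^ 2 * (E * χ₀) - 2 / (T * R) * (E * χ₁) + E * χ₂ / R ^ 2))) * (T * A + T * B)) -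
      χ₀ * ((P.γ * (2 * T - (A + B)) - 2 * P.γ * Hx) * E) =
      P.γ / R * (E * χ₁ * (2 * T * Hx - Hx * (A + B) + 2 * T * (A + B)) + T * (E * Hx * (A + B)) * χ₂ / R) := by
    field_simp
    ring
  rw [key, abs_mul, abs_div, abs_of_nonneg hγ, abs_of_pos hR0, div_mul_eq_mul_div]
  apply div_le_div_of_nonneg_right _ hR0.le
  apply mul_le_mul_of_nonneg_left _ hγ
  have hχ₁ := hM₁ (Hx / R)
  have hχ₂ := hM₂ (Hx / R)
  have t1 : |E * χ₁ * (2 * T * Hx - Hx * (A + B) + 2 * T * (A + B))| ≤ M₁ * (26 * T ^ 2) := by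
    rw [abs_mul, abs_mul, abs_of_pos hE0]
    have h3 : |2 * T * Hx - Hx * (A + B) + 2 * T * (A + B)| ≤ 2 * T * Hx + Hx * (A + B) + 2 * T * (A + B) := by
      rw [abs_le]; constructor <;> nlinarith [mul_nonneg hH0 (add_nonneg hA0 hB0)]
    calc E * |χ₁| * |2 * T * Hx - Hx * (A + B) + 2 * T * (A + B)|
        ≤ E * |χ₁| * (2 * T * Hx + Hx * (A + B) + 2 * T * (A + B)) :=
          mul_le_mul_of_nonneg_left h3 (by positivity)
      _ = |χ₁| * (2 * T * (E * Hx) + E * Hx * (A + B) + 2 * T * (E * (A + B))) := by ring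
      _ ≤ M₁ * (2 * T * T + 16 * T ^ 2 + 2 * T * (4 * T)) := by
          apply mul_le_mul hχ₁ _ (by positivity) hM₁0
          exact add_le_add (add_le_add (mul_le_mul_of_nonneg_left hEH (by positivity)) hEHS)
            (mul_le_mul_of_nonneg_left hES (by positivity))
      _ = M₁ * (26 * T ^ 2) := by ring
  have t2 : |T * (E * Hx * (A + B)) * χ₂ / R| ≤ M₂ * (16 * T ^ 3) := by
    have hQ0 : 0 ≤ T * (E * Hx * (A + B)) := by positivity
    rw [abs_div, abs_of_pos hR0, abs_mul, abs_of_nonneg hQ0]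
    calc T * (E * Hx * (A + B)) * |χ₂| / R ≤ T * (E * Hx * (A + B)) * |χ₂| / 1 := by
          apply div_le_div_of_nonneg_left _ one_pos hR; positivity
      _ = |χ₂| * (T * (E * Hx * (A + B))) := by ring
      _ ≤ M₂ * (T * (16 * T ^ 2)) := by
          apply mul_le_mul hχ₂ _ (by positivity) hM₂0
          exact mul_le_mul_of_nonneg_left hEHS hT.le
      _ = M₂ * (16 * T ^ 3) := by ring
  calc |E * χ₁ * (2 * T * Hx - Hx * (A + B) + 2 * T * (A + B)) + T * (E * Hx * (A + B)) * χ₂ / R|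
      ≤ |E * χ₁ * (2 * T * Hx - Hx * (A + B) + 2 * T * (A + B))| + |T * (E * Hx * (A + B)) * χ₂ / R| :=
        abs_add_le _ _
    _ ≤ M₁ * (26 * T ^ 2) + M₂ * (16 * T ^ 3) := add_le_add t1 t2


/-- **Doob–Dynkin for the energy: the energy-weighted Gibbs density under the reversed kernels at equal bath
temperatures.** For a chain with confining potentials, `N ≥ 1`, `T > 0`, every `u ≥ 0` and `y`:
`e^{2γu} ∫ H e^{-H/T} dP̂_u(y,·) - H(y) e^{-H(y)/T} = ∫₀ᵘ e^{2γs} ∫ γ(2T - p_0² - p_{N-1}²) e^{-H/T} dP̂_s(y,·) ds`,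
`P̂` the transition kernels of the time-reversed Langevin equation (`langevinRevKernel`) — i.e.
`d/ds [e^{2γs} P̂_s(ρH)] = e^{2γs} P̂_s(ρ · LH)` with `LH = γ(2T - p_0² - p_{N-1}²)` the forward generator of the energy.
Proof: Dynkin's identity (`RegularConfinedDrift.sdeKernel_dynkin`) for the truncations `H e^{-H/T}χ(H/R) ∈ C²_c`,
`revGenerator_truncGibbsH_sub_le`, dominated convergence `R → ∞` (all integrands are bounded:
`H e^{-H/T} ≤ T`, `(p_0² + p_{N-1}²) e^{-H/T} ≤ 4T`), and the integrating factor `e^{2γs}`. [folklore] -/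
theorem gibbsDensityH_langevinRevKernel_identity (hP : P.IsConfining) (hN : 0 < N) {T : ℝ} (hT : 0 < T)
    {u : ℝ} (hu : 0 ≤ u) (y : PhaseSpace N) :
    Real.exp (2 * P.γ * u) *
          ∫ x, P.hamiltonian N x * P.gibbsDensity N T x ∂(P.langevinRevKernel N T T u.toNNReal y) -
        P.hamiltonian N y * P.gibbsDensity N T y =
      ∫ s in (0 : ℝ)..u, Real.exp (2 * P.γ * s) *
        ∫ x, P.γ * (2 * T - (x.2 ⟨0, hN⟩ ^ 2 + x.2 ⟨N - 1, Nat.sub_lt hN one_pos⟩ ^ 2)) *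
          P.gibbsDensity N T x ∂(P.langevinRevKernel N T T s.toNNReal y) := by
  -- notation and basic facts
  set D := hP.reversedDrift N with hD
  have hv₁ := hP.bathVecL_mem_reversedDrift_noise N T
  have hv₂ := hP.bathVecR_mem_reversedDrift_noise N T
  set κ : ℝ≥0 → Kernel (PhaseSpace N) (PhaseSpace N) := P.langevinRevKernel N T T with hκ
  have hκs : ∀ s, κ s = sdeKernel (fun y => -P.drift N y) (P.bathVecL N T) (P.bathVecR N T) s := fun s => rfl
  haveI hprob : ∀ s z, IsProbabilityMeasure (κ s z) := fun s z => isProbabilityMeasure_langevinRevKernel hP N T T s z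
  set Hm := P.hamiltonian N with hHm
  set ρ : PhaseSpace N → ℝ := P.gibbsDensity N T with hρdef
  have hρ : ρ = fun x => Real.exp (-Hm x / T) := rfl
  have hH2 : ContDiff ℝ 2 Hm := P.contDiff_hamiltonian hP.contDiff_U hP.contDiff_V N
  have hHc : Continuous Hm := hH2.continuous
  have hH0 : ∀ x, 0 ≤ Hm x := fun x => P.hamiltonian_nonneg_of_nonneg hP.U_nonneg hP.V_nonneg N x
  have hρc : Continuous ρ := by rw [hρ]; fun_prop
  have hρ0 : ∀ x, 0 ≤ ρ x := fun x => (Real.exp_pos _).le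
  have hρ1 : ∀ x, ρ x ≤ 1 := fun x => by
    rw [hρ]; dsimp only; rw [Real.exp_le_one_iff, neg_div]; exact neg_nonpos.2 (div_nonneg (hH0 x) hT.le)
  have hγ2 : 0 ≤ 2 * P.γ := by linarith [hP.γ_nonneg]
  -- the observable `g = H ρ`, bounded by `T`
  set g : PhaseSpace N → ℝ := fun x => Hm x * ρ x with hg
  have hgc : Continuous g := hHc.mul hρc
  have hg0 : ∀ x, 0 ≤ g x := fun x => mul_nonneg (hH0 x) (hρ0 x)
  have hgT : ∀ x, g x ≤ T := fun x => mul_exp_neg_div_le hT (Hm x)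
  have hgn : ∀ x, ‖g x‖ ≤ T := fun x => by rw [Real.norm_of_nonneg (hg0 x)]; exact hgT x
  -- the weight `W = γ(2T - S)`, `S = p_0² + p_{N-1}²`; `W ρ` is bounded by `6γT`
  set W : PhaseSpace N → ℝ := fun x =>
    P.γ * (2 * T - (x.2 ⟨0, hN⟩ ^ 2 + x.2 ⟨N - 1, Nat.sub_lt hN one_pos⟩ ^ 2)) with hW
  have hWc : Continuous W := by rw [hW]; fun_prop
  have hWρ : ∀ x, |W x * ρ x| ≤ 6 * P.γ * T := fun x => by
    set S := x.2 ⟨0, hN⟩ ^ 2 + x.2 ⟨N - 1, Nat.sub_lt hN one_pos⟩ ^ 2 with hS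
    have hk := P.kinetic_le_hamiltonian_of_nonneg hP.U_nonneg hP.V_nonneg N x
    have h1 : x.2 ⟨0, hN⟩ ^ 2 / 2 ≤ ∑ i, x.2 i ^ 2 / 2 :=
      Finset.single_le_sum (f := fun i => x.2 i ^ 2 / 2) (fun i _ => by positivity) (Finset.mem_univ _)
    have h2 : x.2 ⟨N - 1, Nat.sub_lt hN one_pos⟩ ^ 2 / 2 ≤ ∑ i, x.2 i ^ 2 / 2 :=
      Finset.single_le_sum (f := fun i => x.2 i ^ 2 / 2) (fun i _ => by positivity) (Finset.mem_univ _)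
    have hSρ : S * ρ x ≤ 4 * T := by
      have := mul_exp_neg_div_le hT (Hm x)
      calc S * ρ x ≤ 4 * Hm x * ρ x := mul_le_mul_of_nonneg_right (by rw [hS, hHm]; linarith) (hρ0 x)
        _ ≤ 4 * T := by rw [hρ]; dsimp only; linarith
    have habs : |2 * T - S| ≤ 2 * T + S := by rw [abs_le]; constructor <;> nlinarith [sq_nonneg (x.2 ⟨0, hN⟩)]
    rw [hW, abs_mul, abs_mul, abs_of_nonneg hP.γ_nonneg, abs_of_nonneg (hρ0 x)]
    calc P.γ * |2 * T - S| * ρ x ≤ P.γ * (2 * T + S) * ρ x :=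
          mul_le_mul_of_nonneg_right (mul_le_mul_of_nonneg_left habs hP.γ_nonneg) (hρ0 x)
      _ = P.γ * (2 * T * ρ x + S * ρ x) := by ring
      _ ≤ P.γ * (2 * T * 1 + 4 * T) := mul_le_mul_of_nonneg_left
          (add_le_add (mul_le_mul_of_nonneg_left (hρ1 x) (by linarith)) hSρ) hP.γ_nonneg
      _ = 6 * P.γ * T := by ring
  have hWρn : ∀ x, ‖W x * ρ x‖ ≤ 6 * P.γ * T := fun x => by rw [Real.norm_eq_abs]; exact hWρ x
  -- the limit generator image `m = W ρ - 2γ g`, bounded by `B₀`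
  set m : PhaseSpace N → ℝ := fun x => (W x - 2 * P.γ * Hm x) * ρ x with hm
  have hmc : Continuous m := by rw [hm]; exact (hWc.sub (continuous_const.mul hHc)).mul hρc
  set B₀ : ℝ := 6 * P.γ * T + 2 * P.γ * T with hB₀
  have hmn : ∀ x, ‖m x‖ ≤ B₀ := fun x => by
    have e : m x = W x * ρ x + -(2 * P.γ) * g x := by rw [hm, hg]; ring
    rw [Real.norm_eq_abs, e]
    refine (abs_add_le _ _).trans (add_le_add (hWρ x) ?_)
    rw [abs_mul, abs_neg, abs_of_nonneg hγ2, abs_of_nonneg (hg0 x)]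
    exact mul_le_mul_of_nonneg_left (hgT x) hγ2
  -- the truncations `g_R = H e^{-H/T} χ(H/R)`
  set gR : ℕ → PhaseSpace N → ℝ := fun n x =>
    Hm x * (Real.exp (-Hm x / T) * smoothCutoff (Hm x / (n + 1))) with hgR
  have hRpos : ∀ n : ℕ, (0:ℝ) < n + 1 := fun n => by positivity
  have hgR2 : ∀ n, ContDiff ℝ 2 (gR n) := fun n => by
    have h1 : ContDiff ℝ 2 fun x => Real.exp (-Hm x / T) := (hH2.neg.div_const T).exp
    have h2 : ContDiff ℝ 2 fun x => smoothCutoff (Hm x / (n + 1)) :=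
      (contDiff_smoothCutoff (n := 2)).comp (hH2.div_const _)
    exact hH2.mul (h1.mul h2)
  have hgRc : ∀ n, Continuous (gR n) := fun n => (hgR2 n).continuous
  have hgRsupp : ∀ n, HasCompactSupport (gR n) := fun n => by
    refine HasCompactSupport.intro (hP.isCompact_setOf_hamiltonian_le N (2 * (n + 1))) fun x hx => ?_
    simp only [mem_setOf_eq, not_le] at hx
    have h2 : 2 ≤ Hm x / (n + 1) := by rw [le_div_iff₀ (hRpos n)]; linarith
    show Hm x * (Real.exp (-Hm x / T) * smoothCutoff (Hm x / (n + 1))) = 0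
    rw [smoothCutoff_of_two_le h2, mul_zero, mul_zero]
  have hgR0 : ∀ n x, 0 ≤ gR n x := fun n x => mul_nonneg (hH0 x) (mul_nonneg (Real.exp_pos _).le (smoothCutoff_nonneg _))
  have hgRle : ∀ n x, gR n x ≤ g x := fun n x => by
    show Hm x * (Real.exp (-Hm x / T) * smoothCutoff (Hm x / (n + 1))) ≤ Hm x * ρ x
    rw [hρ]
    exact mul_le_mul_of_nonneg_left (mul_le_of_le_one_right (Real.exp_pos _).le (smoothCutoff_le_one _)) (hH0 x)
  have hgRn : ∀ n x, ‖gR n x‖ ≤ T := fun n x => by rw [Real.norm_of_nonneg (hgR0 n x)]; exact (hgRle n x).trans (hgT x)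
  have hcut : ∀ x, ∀ᶠ n : ℕ in atTop, smoothCutoff (Hm x / (n + 1)) = 1 := fun x => by
    obtain ⟨n₀, hn₀⟩ := exists_nat_ge (Hm x)
    filter_upwards [eventually_ge_atTop n₀] with n hn
    have : (n₀ : ℝ) ≤ n := by exact_mod_cast hn
    exact smoothCutoff_of_le_one (by rw [div_le_one (hRpos n)]; linarith)
  have hgRlim : ∀ x, Tendsto (fun n => gR n x) atTop (𝓝 (g x)) := fun x => by
    refine tendsto_const_nhds.congr' ?_
    filter_upwards [hcut x] with n hn
    show g x = Hm x * (Real.exp (-Hm x / T) * smoothCutoff (Hm x / (n + 1))); rw [hn, mul_one, hg, hρ]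
  -- the generator of the truncations: main part `χ m` plus an `O(1/R)` error
  obtain ⟨C, hC⟩ := revGenerator_truncGibbsH_sub_le hP.contDiff_U hP.contDiff_V hP.U_nonneg hP.V_nonneg hN hP.γ_nonneg hT
  set L := sdeGenerator (fun y => -P.drift N y) (P.bathVecL N T) (P.bathVecR N T) with hL
  set mR : ℕ → PhaseSpace N → ℝ := fun n x => smoothCutoff (Hm x / (n + 1)) * m x with hmR
  set eR : ℕ → PhaseSpace N → ℝ := fun n x => L (gR n) x - mR n x with heR
  have heRb : ∀ n x, |eR n x| ≤ C / (n + 1) := fun n x => hC (n + 1) (by linarith [(n.cast_nonneg : (0:ℝ) ≤ n)]) x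
  have hC0 : 0 ≤ C := by simpa using (abs_nonneg _).trans (heRb 0 y)
  have hYc : Continuous fun y => -P.drift N y := D.contDiff_drift.continuous
  have hmRc : ∀ n, Continuous (mR n) := fun n => (contDiff_smoothCutoff (n := 0)).continuous.comp (hHc.div_const _) |>.mul hmc
  have hmRn : ∀ n x, ‖mR n x‖ ≤ B₀ := fun n x => by
    rw [hmR]; dsimp only; rw [norm_mul, Real.norm_of_nonneg (smoothCutoff_nonneg _)]
    exact (mul_le_of_le_one_left (norm_nonneg _) (smoothCutoff_le_one _)).trans (hmn x)
  have hmRlim : ∀ x, Tendsto (fun n => mR n x) atTop (𝓝 (m x)) := fun x => by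
    refine tendsto_const_nhds.congr' ?_
    filter_upwards [hcut x] with n hn
    show m x = smoothCutoff (Hm x / (n + 1)) * m x; rw [hn, one_mul]
  have heRc : ∀ n, Continuous (eR n) := fun n => (continuous_sdeGenerator _ _ hYc (hgR2 n)).sub (hmRc n)
  have hLgR : ∀ n x, L (gR n) x = mR n x + eR n x := fun n x => by simp only [heR]; ring
  -- kernel integrals as functions of real time
  set Φ : ℝ → ℝ := fun s => ∫ x, g x ∂(κ s.toNNReal y) with hΦ
  set Ψ : ℝ → ℝ := fun s => ∫ x, W x * ρ x ∂(κ s.toNNReal y) with hΨ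
  set ΦR : ℕ → ℝ → ℝ := fun n s => ∫ x, gR n x ∂(κ s.toNNReal y) with hΦR
  set MR : ℕ → ℝ → ℝ := fun n s => ∫ x, mR n x ∂(κ s.toNNReal y) with hMR
  set ER : ℕ → ℝ → ℝ := fun n s => ∫ x, eR n x ∂(κ s.toNNReal y) with hER
  have hΦc : Continuous Φ := continuous_integral_langevinRevKernel hP N T T y hgc hgn
  have hΨc : Continuous Ψ := continuous_integral_langevinRevKernel hP N T T y (hWc.mul hρc) hWρn
  have hΦRc : ∀ n, Continuous (ΦR n) := fun n => continuous_integral_langevinRevKernel hP N T T y (hgRc n) (hgRn n)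
  have hMRc : ∀ n, Continuous (MR n) := fun n => continuous_integral_langevinRevKernel hP N T T y (hmRc n) (hmRn n)
  have hERc : ∀ n, Continuous (ER n) := fun n => continuous_integral_langevinRevKernel hP N T T y (heRc n)
    (C := C / (n + 1)) fun x => by rw [Real.norm_eq_abs]; exact heRb n x
  have hMRle : ∀ n s, |MR n s| ≤ B₀ := fun n s => by
    have := norm_integral_le_of_norm_le_const (μ := κ s.toNNReal y) (Eventually.of_forall (hmRn n))
    simpa [probReal_univ] using this
  have hERle : ∀ n s, |ER n s| ≤ C / (n + 1) := fun n s => by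
    have := norm_integral_le_of_norm_le_const (μ := κ s.toNNReal y)
      (Eventually.of_forall (fun x => show ‖eR n x‖ ≤ C / (n + 1) by rw [Real.norm_eq_abs]; exact heRb n x))
    simpa [probReal_univ] using this
  -- the limit of the main part: `∫ m dP̂_s(y,·) = -2γ Φ s + Ψ s`
  have hmint : ∀ s, ∫ x, m x ∂(κ s.toNNReal y) = -(2 * P.γ) * Φ s + Ψ s := by
    intro s
    have hi1 : Integrable g (κ s.toNNReal y) :=
      (integrable_const T).mono' hgc.aestronglyMeasurable (Eventually.of_forall hgn)
    have hi2 : Integrable (fun x => W x * ρ x) (κ s.toNNReal y) :=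
      (integrable_const (6 * P.γ * T)).mono' (hWc.mul hρc).aestronglyMeasurable (Eventually.of_forall hWρn)
    have e : m = fun x => -(2 * P.γ) * g x + W x * ρ x := by funext x; simp only [hm, hg]; ring
    simp only [hΦ, hΨ]; rw [e, integral_add (hi1.const_mul _) hi2, integral_const_mul]
  -- Dynkin for the truncations: `ΦR n v - gR n y = ∫₀ᵛ (MR n s + ER n s) ds`, `v ≥ 0`
  have hdyn : ∀ (n : ℕ) (v : ℝ), 0 ≤ v → ΦR n v - gR n y = ∫ s in (0:ℝ)..v, (MR n s + ER n s) := by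
    intro n v hv
    have h := D.sdeKernel_dynkin hv₁ hv₂ (hgR2 n) (hgRsupp n) v.toNNReal y
    rw [Real.coe_toNNReal _ hv, ← hκs] at h
    simp only [hΦR, hMR, hER]; rw [h]; refine intervalIntegral.integral_congr fun s _ => ?_
    rw [← hκs]
    have hint1 : Integrable (mR n) (κ s.toNNReal y) :=
      (integrable_const B₀).mono' (hmRc n).aestronglyMeasurable (Eventually.of_forall (hmRn n))
    have hint2 : Integrable (eR n) (κ s.toNNReal y) :=
      (integrable_const (C / (n + 1))).mono' (heRc n).aestronglyMeasurable
        (Eventually.of_forall fun x => by rw [Real.norm_eq_abs]; exact heRb n x)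
    have e1 : (fun x => L (gR n) x) = fun x => mR n x + eR n x := funext (hLgR n)
    show ∫ x, L (gR n) x ∂(κ s.toNNReal y) = (∫ x, mR n x ∂(κ s.toNNReal y)) + ∫ x, eR n x ∂(κ s.toNNReal y)
    rw [e1, integral_add hint1 hint2]
  -- pass to the limit `n → ∞`
  have hlim : ∀ v : ℝ, 0 ≤ v → Φ v - g y = ∫ s in (0:ℝ)..v, (-(2 * P.γ) * Φ s + Ψ s) := by
    intro v hv
    have hL1 : Tendsto (fun n => ΦR n v - gR n y) atTop (𝓝 (Φ v - g y)) := by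
      refine Tendsto.sub ?_ (hgRlim y)
      simp only [hΦR, hΦ]
      exact tendsto_integral_of_dominated_convergence (fun _ => T)
        (fun n => (hgRc n).aestronglyMeasurable) (integrable_const T)
        (fun n => Eventually.of_forall (hgRn n)) (Eventually.of_forall hgRlim)
    have hL2 : Tendsto (fun n => ∫ s in (0:ℝ)..v, (MR n s + ER n s)) atTop
        (𝓝 (∫ s in (0:ℝ)..v, (-(2 * P.γ) * Φ s + Ψ s))) := by
      refine intervalIntegral.tendsto_integral_filter_of_dominated_convergence (fun _ => B₀ + C) ?_ ?_ ?_ ?_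
      · exact Eventually.of_forall fun n => ((hMRc n).add (hERc n)).aestronglyMeasurable
      · refine Eventually.of_forall fun n => Eventually.of_forall fun s _ => ?_
        have h3 : C / (n + 1) ≤ C := div_le_self hC0 (by linarith [(n.cast_nonneg : (0:ℝ) ≤ n)])
        rw [Real.norm_eq_abs]
        exact (abs_add_le _ _).trans (add_le_add (hMRle n s) ((hERle n s).trans h3))
      · exact intervalIntegrable_const
      · refine Eventually.of_forall fun s _ => ?_
        have hA : Tendsto (fun n => MR n s) atTop (𝓝 (∫ x, m x ∂(κ s.toNNReal y))) := by
          simp only [hMR]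
          exact tendsto_integral_of_dominated_convergence (fun _ => B₀)
            (fun n => (hmRc n).aestronglyMeasurable) (integrable_const B₀)
            (fun n => Eventually.of_forall (hmRn n)) (Eventually.of_forall hmRlim)
        have hCn : Tendsto (fun n : ℕ => C / (n + 1)) atTop (𝓝 0) :=
          tendsto_const_nhds.div_atTop (tendsto_natCast_atTop_atTop.atTop_add tendsto_const_nhds)
        have := hA.add (squeeze_zero_norm (fun n => by rw [Real.norm_eq_abs]; exact hERle n s) hCn)
        rwa [hmint s, add_zero] at this
    rw [show (fun n => ΦR n v - gR n y) = fun n => ∫ s in (0:ℝ)..v, (MR n s + ER n s) from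
      funext fun n => hdyn n v hv] at hL1
    exact tendsto_nhds_unique hL1 hL2
  -- the integrating factor: `e^{2γs} Φ(s)` has derivative `e^{2γs} Ψ(s)` on `(0, u)`
  set Θ : ℝ → ℝ := fun s => Real.exp (2 * P.γ * s) * Φ s with hΘ
  have hΘc : Continuous Θ := (Real.continuous_exp.comp (continuous_const.mul continuous_id)).mul hΦc
  have hderiv : ∀ s ∈ Ioo (0:ℝ) u, HasDerivAt Θ (Real.exp (2 * P.γ * s) * Ψ s) s := by
    intro s hs
    have hs0 : 0 < s := hs.1
    have hF : HasDerivAt (fun r => g y + ∫ τ in (0:ℝ)..r, (-(2 * P.γ) * Φ τ + Ψ τ))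
        (-(2 * P.γ) * Φ s + Ψ s) s := by
      have hcts : Continuous fun τ => -(2 * P.γ) * Φ τ + Ψ τ := (continuous_const.mul hΦc).add hΨc
      exact (hcts.integral_hasStrictDerivAt 0 s).hasDerivAt.const_add (g y)
    have hΦd : HasDerivAt Φ (-(2 * P.γ) * Φ s + Ψ s) s := by
      refine hF.congr_of_eventuallyEq ?_
      filter_upwards [Ioi_mem_nhds hs0] with r hr
      have := hlim r (le_of_lt hr)
      show Φ r = g y + ∫ τ in (0:ℝ)..r, (-(2 * P.γ) * Φ τ + Ψ τ); linarith
    have h1 : HasDerivAt (fun r : ℝ => 2 * P.γ * r) (2 * P.γ) s := by simpa using (hasDerivAt_id s).const_mul (2 * P.γ)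
    exact (h1.exp.mul hΦd).congr_deriv (by ring)
  have hFTC := intervalIntegral.integral_eq_sub_of_hasDerivAt_of_le hu hΘc.continuousOn hderiv
    (((Real.continuous_exp.comp (continuous_const.mul continuous_id)).mul hΨc).intervalIntegrable _ _)
  have h0 : Φ 0 = g y := sub_eq_zero.1 (by simpa using hlim 0 le_rfl)
  rw [show Θ 0 = g y by simp [hΘ, h0]] at hFTC
  show Θ u - g y = ∫ s in (0:ℝ)..u, Real.exp (2 * P.γ * s) * Ψ s; rw [hFTC]

/-- **Registered sub-goal `sumRule_energyDoobDynkin`** of crux stmt-AtomisticToContinuum-11812 (under `stub_sumRule`,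
line `gibbs-ttcf`): `gibbsDensityH_langevinRevKernel_identity` for the pinned anharmonic chain with `N + 1` sites
(`ω₂ > 0`, `lam, β, γ ≥ 0`, `T > 0`, `u ≥ 0`), weight `γ(2T - p_0² - p_N²)`. [folklore] -/
theorem sumRule_energyDoobDynkin :
    ∀ ω₂ lam β γ : ℝ, 0 < ω₂ → 0 ≤ lam → 0 ≤ β → 0 ≤ γ → ∀ (N : ℕ) (T : ℝ), 0 < T → ∀ u : ℝ, 0 ≤ u → ∀ y : PhaseSpace (N + 1), Real.exp (2 * γ * u) * (∫ x, (pinnedChain ω₂ lam β γ).hamiltonian (N + 1) x * (pinnedChain ω₂ lam β γ).gibbsDensity (N + 1) T x ∂((pinnedChain ω₂ lam β γ).langevinRevKernel (N + 1) T T u.toNNReal y)) - (pinnedChain ω₂ lam β γ).hamiltonian (N + 1) y * (pinnedChain ω₂ lam β γ).gibbsDensity (N + 1) T y = ∫ s in (0 : ℝ)..u, Real.exp (2 * γ * s) * ∫ x, γ * (2 * T - ((x.2 0) ^ 2 + (x.2 (Fin.last N)) ^ 2)) * (pinnedChain ω₂ lam β γ).gibbsDensity (N + 1) T x ∂((pinnedChain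 ω₂ lam β γ).langevinRevKernel (N + 1) T T s.toNNReal y) :=
  fun _ _ _ _ hω hl hβ hγ N _ hT _ hu y =>
    gibbsDensityH_langevinRevKernel_identity (pinnedChain_isConfining hω hl hβ hγ) (Nat.succ_pos N) hT hu y

end Summit.AtomisticToContinuum.FouriersLaw.Theorems.BoundaryKubo.GibbsTtcf

end
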